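import Summits.QuantumFields.YangMills.Theorems.F4SubCurvatureDoorSubCurvatureClauseDensityTransfer
import Summits.QuantumFields.YangMills.Theorems.LangevinControlUVOSLegsFromFemtoAndGapStubAssemblyLowDegree
import Literature.MathematicalPhysics.QuantumFieldTheory.SpeciesTimeReflection
import Literature.MathematicalPhysics.QuantumLattice.LatticeGaugeDLRCovarianceSplit
import HarnessLib

/-!
# Route `F4SubCurvatureDoor`, crux `SubCurvatureClause` ⟨stmt-QuantumFields-23763⟩ — LATTICE-TO-AXIS tools (local density bound; the
# two-point weight as a truncated covariance; axis domination under a two-sided axis window)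

Helper file (`--supports stmt-QuantumFields-23763 --as helper`; free-hands seat `ym-line-frs-p2` g19).  Definition-free, 0 sorry, standard
axioms.  Tools for the soft stub `LatticeToAxis` of the crux idea «rp-moebius-ladder» (ideator ym-idea-3 g24, HOME `g24/Sketch.lean` :107–123),
proved in `Theorems/F4SubCurvatureDoorSubCurvatureClauseLatticeToAxis.lean`:

* `abs_le_of_local_density_bound` (§1, kernel-generic): the LOCAL form of ✓`abs_le_of_density_bound` — a density bound `‖S₂ F‖ ≤ B ∫‖F‖`
  for test functions whose difference variable stays in a ball around `x₀ ≠ 0` already gives `|K x₀| ≤ B`;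
* `integral_shift_lift`, `integral_mul_shift_lift`, `pair_integral_neg`, `torusMoment_two_eq_cov` (§2): the centred two-point weight of the
  lattice distribution at the sites `(x₀, x₁)` is the truncated covariance `Cov(Q_0, Q_z)`, `z = x₀ − x₁`, in the letters of
  ✓`CurvatureKernel.AxisDominationOfForm` (translation invariance and evenness of Wilson's torus state);
* `abs_cov_le_of_axis_window` (§2): the axis-domination inequality `Cov(Q_0,Q_z)² ≤ lCC(Q,Q^θ,2⌈n/2⌉)·lCC(Q^θ,Q,2⌊n/2⌋)` (`z₀ = n ≥ 3`; the
  conclusion of ✓`CurvatureKernel.AxisDominationOfForm`) turns the two axis window bounds `(2t)⁸·lCC ≤ B` into `|Cov(Q_0, Q_z)| ≤ B/(n−1)⁸`.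

[cite: OsterwalderSeiler1978, §2]; [folklore; Hörmander ALPDO I, Thm 1.2.5].

HONEST LABEL: tools for a soft stub; the crux content (`MoebiusRow`, `CrossoverDecay`) is untouched; ⟨23763⟩, ⟨23036⟩ open; the Yang–Mills mass
gap is NOT proved; no summit is proved by a line.
-/

set_option autoImplicit false

noncomputable section

open scoped SchwartzMap BigOperators ContDiff
open MeasureTheory Filter Topology Metric Set
open Literature.MathematicalPhysics.QuantumFieldTheory Literature.MathematicalPhysics.QuantumLattice
open Literature.MathematicalPhysics.AQFT
open Literature.Probability.LatticeModels (box Site mem_box)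
open Summit.QuantumFields.YangMills.Cruxes.OSLegsFromFemtoAndGap.DlrCollarTransfer (dens torusE MomentBounds6)
open Summit.QuantumFields.YangMills.Cruxes.OSLegsAtWeakCouplingC.Sketch (tendsto_riemann_sum)
open Summit.QuantumFields.YangMills.Theorems.OSLegsFromFemtoAndGap
open Summit.QuantumFields.YangMills.Theorems.ROT (IsLegScheme OffDiagLimitAlong)
open Summit.QuantumFields.YangMills.Theorems.NPointIsotropy.Negative (E4)
open Summit.QuantumFields.YangMills.Theorems.F4SubCurvatureDoorSubCurvatureKernelFaithful
  (integral_fin_two_shear continuous_mul_of_tsupport_subset)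

namespace Summit.QuantumFields.YangMills.Theorems.F4SubCurvatureDoorSubCurvatureClauseLatticeToAxisTools

/-! ## §1 The local form of the pointwise-from-density bound (kernel-generic) -/

/-- **Pointwise bound from a LOCAL density bound.**  If `K` is continuous off `0` and represents `S₂` on compactly supported off-diagonal
test functions, `x₀ ≠ 0`, `ρ > 0`, and `‖S₂ F‖ ≤ B ∫‖F‖` for every compactly supported `F` whose support sees only difference vectors
`y₀ − y₁ ∈ closedBall x₀ ρ`, then `|K x₀| ≤ B` (test functions `g(y₀ − y₁) χ(y₁)` with a normed bump `g` of small radius at `x₀`).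
[folklore; Hörmander ALPDO I, Thm 1.2.5] -/
theorem abs_le_of_local_density_bound (K : E4 → ℝ) (hKc : ContinuousOn K {x | x ≠ 0})
    (S₂ : 𝓢((Fin 2 → E4), ℂ) →L[ℂ] ℂ)
    (hrep : ∀ F : 𝓢((Fin 2 → E4), ℂ), IsOffDiagonal F → HasCompactSupport (F : (Fin 2 → E4) → ℂ) →
      Integrable (fun x : Fin 2 → E4 => (K (x 0 - x 1) : ℂ) * F x) ∧
        S₂ F = ∫ x : Fin 2 → E4, (K (x 0 - x 1) : ℂ) * F x)
    {x₀ : E4} (hx₀ : x₀ ≠ 0) {ρ B : ℝ} (hρ : 0 < ρ)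
    (hB : ∀ F : 𝓢((Fin 2 → E4), ℂ), HasCompactSupport (F : (Fin 2 → E4) → ℂ) →
      tsupport (F : (Fin 2 → E4) → ℂ) ⊆ {y | y 0 - y 1 ∈ closedBall x₀ ρ} → ‖S₂ F‖ ≤ B * ∫ x, ‖F x‖) :
    |K x₀| ≤ B := by
  -- adapted from ✓`F4SubCurvatureDoorSubCurvatureClauseDensityTransfer.abs_le_of_density_bound` (support localised at `x₀`)
  have hn0 : 0 < ‖x₀‖ := norm_pos_iff.2 hx₀
  refine le_of_forall_pos_le_add fun ε hε => ?_
  -- continuity of `K` at `x₀`: radius `η`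
  have hKat : ContinuousAt K x₀ := hKc.continuousAt (isOpen_ne.mem_nhds hx₀)
  obtain ⟨η, hη, hKη⟩ := Metric.continuousAt_iff.1 hKat ε hε
  -- the bump radius `η' < min (min η ρ) ‖x₀‖`
  set η' : ℝ := min (min η ρ) ‖x₀‖ / 2 with hη'
  have hmin : 0 < min (min η ρ) ‖x₀‖ := lt_min (lt_min hη hρ) hn0
  have hη'0 : 0 < η' := by positivity
  have hη'η : η' < η := by
    have := (min_le_left (min η ρ) ‖x₀‖).trans (min_le_left η ρ)
    rw [hη']; linarith
  have hη'ρ : η' ≤ ρ := by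
    have := (min_le_left (min η ρ) ‖x₀‖).trans (min_le_right η ρ)
    rw [hη']; linarith
  have hη'n : η' < ‖x₀‖ := by
    have := min_le_right (min η ρ) ‖x₀‖
    rw [hη']; linarith
  -- the normed bump `g` at `x₀` of outer radius `η'`, and a normed bump `χ` at `0`
  let bg : ContDiffBump x₀ := ⟨η' / 2, η', by positivity, by linarith⟩
  set g : E4 → ℝ := bg.normed volume with hg
  have hgs : ContDiff ℝ ∞ g := bg.contDiff_normed
  have hgc : HasCompactSupport g := bg.hasCompactSupport_normed
  have hg1 : ∫ x, g x = 1 := bg.integral_normed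
  have hgi : Integrable g := bg.integrable_normed
  have hg0 : ∀ x, 0 ≤ g x := fun x => bg.nonneg_normed x
  have hgsupp : tsupport g ⊆ closedBall x₀ η' := by
    rw [hg, bg.tsupport_normed_eq]
  let b : ContDiffBump (0 : E4) := ⟨1, 2, one_pos, one_lt_two⟩
  set χ : E4 → ℝ := b.normed volume with hχ
  have hχs : ContDiff ℝ ∞ χ := b.contDiff_normed
  have hχc : HasCompactSupport χ := b.hasCompactSupport_normed
  have hχ1 : ∫ x, χ x = 1 := b.integral_normed
  have hχi : Integrable χ := b.integrable_normed
  have hχ0 : ∀ x, 0 ≤ χ x := fun x => b.nonneg_normed x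
  -- points of `tsupport g` are off `0` and within `η` of `x₀`
  have hgU : tsupport g ⊆ {x | x ≠ 0} := by
    intro u hu h0
    have h1 : dist u x₀ ≤ η' := mem_closedBall.1 (hgsupp hu)
    rw [h0, dist_comm, dist_zero_right] at h1
    linarith
  have hgη : ∀ u ∈ tsupport g, dist (K u) (K x₀) < ε := fun u hu =>
    hKη ((mem_closedBall.1 (hgsupp hu)).trans_lt hη'η)
  -- the test function `f(y) = g(y₀ − y₁) χ(y₁)` and its Schwartz incarnation
  set f : (Fin 2 → E4) → ℂ := fun y => ((g (y 0 - y 1) * χ (y 1) : ℝ) : ℂ) with hf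
  have h0 : ContDiff ℝ ∞ (fun y : Fin 2 → E4 => y 0) := contDiff_apply ℝ E4 0
  have h1 : ContDiff ℝ ∞ (fun y : Fin 2 → E4 => y 1) := contDiff_apply ℝ E4 1
  have hfs : ContDiff ℝ ∞ f :=
    Complex.ofRealCLM.contDiff.comp (((hgs.comp (h0.sub h1)).mul (hχs.comp h1)))
  have hθc : Continuous fun p : E4 × E4 => (![p.1 + p.2, p.2] : Fin 2 → E4) := by
    refine continuous_pi fun i => ?_
    fin_cases i
    · exact (continuous_fst.add continuous_snd).congr fun p => by simp
    · exact continuous_snd.congr fun p => by simp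
  have hfval : ∀ y : Fin 2 → E4, f y ≠ 0 → g (y 0 - y 1) ≠ 0 ∧ χ (y 1) ≠ 0 := by
    intro y hy
    constructor
    · intro h; apply hy; simp [hf, h]
    · intro h; apply hy; simp [hf, h]
  have hfc : HasCompactSupport f := by
    refine HasCompactSupport.intro ((hgc.isCompact.prod hχc.isCompact).image hθc) fun y hy => ?_
    by_contra hne'
    obtain ⟨hg', hχ'⟩ := hfval y hne'
    exact hy ⟨(y 0 - y 1, y 1), ⟨subset_tsupport _ hg', subset_tsupport _ hχ'⟩, by
      funext i; fin_cases i <;> simp⟩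
  set F : 𝓢((Fin 2 → E4), ℂ) := hfc.toSchwartzMap hfs with hFdef
  have hFf : (F : (Fin 2 → E4) → ℂ) = f := rfl
  have hT : tsupport (F : (Fin 2 → E4) → ℂ) ⊆ {y | y 0 - y 1 ∈ tsupport g ∧ y 1 ∈ tsupport χ} := by
    rw [hFf]
    refine closure_minimal (fun y hy => ?_) ?_
    · obtain ⟨hg', hχ'⟩ := hfval y hy
      exact ⟨subset_tsupport _ hg', subset_tsupport _ hχ'⟩
    · exact ((isClosed_tsupport _).preimage ((continuous_apply 0).sub (continuous_apply 1))).inter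
        ((isClosed_tsupport _).preimage (continuous_apply 1))
  -- `F` is compactly supported, localised at `x₀`, and off-diagonal
  have hFc : HasCompactSupport (F : (Fin 2 → E4) → ℂ) := by rw [hFf]; exact hfc
  have hFloc : tsupport (F : (Fin 2 → E4) → ℂ) ⊆ {y | y 0 - y 1 ∈ closedBall x₀ ρ} := fun y hy =>
    closedBall_subset_closedBall hη'ρ (hgsupp (hT hy).1)
  have hFoff : IsOffDiagonal F := by
    refine IsOffDiagonal.of_tsupport_subset fun y hy hco => ?_
    obtain ⟨i, j, hij, hyij⟩ := (mem_coincidenceLocus y).1 hco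
    have hne : y 0 - y 1 ≠ 0 := hgU (hT hy).1
    have h01 : y 0 = y 1 := by
      fin_cases i <;> fin_cases j
      · exact absurd rfl hij
      · exact hyij
      · exact hyij.symm
      · exact absurd rfl hij
    exact hne (sub_eq_zero.2 h01)
  -- `S₂ F = ∫ K g` : the representation, Fubini, `∫ χ = 1`
  obtain ⟨-, hSF⟩ := hrep F hFoff hFc
  set ψ : E4 → ℝ := fun u => g u * K u with hψ
  have hψc : Continuous ψ := continuous_mul_of_tsupport_subset isOpen_ne hKc hgs.continuous hgU
  have hψi : Integrable ψ := hψc.integrable_of_hasCompactSupport hgc.mul_right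
  have hreal : (fun y : Fin 2 → E4 => (K (y 0 - y 1) : ℂ) * F y) =
      fun y => ((χ (y 1) * ψ (y 0 - y 1) : ℝ) : ℂ) := by
    funext y
    rw [show F y = f y from rfl]
    simp only [hf, hψ]
    push_cast
    ring
  have hSψ : S₂ F = ((∫ u, ψ u : ℝ) : ℂ) := by
    rw [hSF, hreal, integral_complex_ofReal, integral_fin_two_shear χ ψ hχi hψi, hχ1, one_mul]
  -- `∫ ‖F‖ = 1`
  have hnormF : ∫ y, ‖F y‖ = 1 := by
    have h : (fun y : Fin 2 → E4 => ‖F y‖) = fun y => χ (y 1) * g (y 0 - y 1) := by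
      funext y
      rw [show F y = f y from rfl]
      simp only [hf, Complex.norm_real, Real.norm_eq_abs, abs_mul, abs_of_nonneg (hg0 _), abs_of_nonneg (hχ0 _)]
      ring
    rw [h, integral_fin_two_shear χ g hχi hgi, hχ1, hg1, one_mul]
  -- `|∫ K g − K x₀| ≤ ε`
  have hclose : |(∫ u, ψ u) - K x₀| ≤ ε := by
    have hKx : ∫ u, g u * K x₀ = K x₀ := by rw [integral_mul_const, hg1, one_mul]
    have hsub : (∫ u, ψ u) - K x₀ = ∫ u, g u * (K u - K x₀) := by
      conv_lhs => rw [← hKx]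
      rw [← integral_sub hψi (hgi.mul_const _)]
      refine integral_congr_ae (Eventually.of_forall fun u => ?_)
      simp only [hψ]
      ring
    rw [hsub]
    have hbd : ∀ u, ‖g u * (K u - K x₀)‖ ≤ ε * g u := by
      intro u
      by_cases hu : u ∈ tsupport g
      · rw [norm_mul, Real.norm_eq_abs, abs_of_nonneg (hg0 u), mul_comm]
        exact mul_le_mul_of_nonneg_right (le_of_lt (by simpa [Real.dist_eq] using hgη u hu)) (hg0 u)
      · have : g u = 0 := image_eq_zero_of_notMem_tsupport hu
        simp [this]
    calc |∫ u, g u * (K u - K x₀)| = ‖∫ u, g u * (K u - K x₀)‖ := (Real.norm_eq_abs _).symm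
      _ ≤ ∫ u, ε * g u := norm_integral_le_of_norm_le (hgi.const_mul ε) (Eventually.of_forall hbd)
      _ = ε := by rw [integral_const_mul, hg1, mul_one]
  -- assemble
  have hSB : |∫ u, ψ u| ≤ B := by
    have h := hB F hFc hFloc
    rw [hSψ, Complex.norm_real, Real.norm_eq_abs, hnormF, mul_one] at h
    exact h
  calc |K x₀| = |(∫ u, ψ u) - ((∫ u, ψ u) - K x₀)| := by ring_nf
    _ ≤ |∫ u, ψ u| + |(∫ u, ψ u) - K x₀| := abs_sub _ _
    _ ≤ B + ε := add_le_add hSB hclose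

/-! ## §2 The two-point weight as a truncated covariance; axis domination under a two-sided axis window -/

variable {G : Type} [Group G] [TopologicalSpace G] [IsTopologicalGroup G] [CompactSpace G]
  [MeasurableSpace G] [BorelSpace G]

/-- Translation invariance of one-point integrals in lifted form. [folklore] -/
theorem integral_shift_lift (r : LatticeRep G) (β : ℝ) (L : ℕ) (A : LGConfig 4 G → ℝ) (x : Site 4) :
    ∫ U, A (configShift (-x) (torusLift (2 * L + 1) U)) ∂(wilsonMeasure r.ρ β : Measure (GaugeConfig 4 (2 * L + 1) G)) =
      ∫ U, A (torusLift (2 * L + 1) U) ∂(wilsonMeasure r.ρ β : Measure (GaugeConfig 4 (2 * L + 1) G)) :=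
  integral_comp_configShift_torusLift (d := 4) (S := 2 * L + 1) r.ρ β A (-x)

/-- Translation invariance of two-point integrals in lifted form: only the separation matters. [folklore] -/
theorem integral_mul_shift_lift (r : LatticeRep G) (β : ℝ) (L : ℕ) (A B : LGConfig 4 G → ℝ) (x y : Site 4) :
    ∫ U, A (configShift (-x) (torusLift (2 * L + 1) U)) * B (configShift (-y) (torusLift (2 * L + 1) U))
        ∂(wilsonMeasure r.ρ β : Measure (GaugeConfig 4 (2 * L + 1) G)) =
      ∫ U, A (torusLift (2 * L + 1) U) * B (configShift (-(y - x)) (torusLift (2 * L + 1) U))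
        ∂(wilsonMeasure r.ρ β : Measure (GaugeConfig 4 (2 * L + 1) G)) := by
  -- adapted from `CurvatureKernel.AxisDom.integral_mul_shift_lift` (module not served at the time of writing)
  have hcomp : ∀ (a b : Site 4) (V : LGConfig 4 G), configShift a (configShift b V) = configShift (a + b) V := by
    intro a b V; funext e; simp only [configShift_apply, sub_sub]
  have hzero : ∀ V : LGConfig 4 G, configShift (0 : Site 4) V = V := by
    intro V; funext e; simp [configShift_apply]
  have h := integral_comp_configShift_torusLift (d := 4) (S := 2 * L + 1) r.ρ β
    (fun V => A (configShift (-x) V) * B (configShift (-y) V)) x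
  simp only [hcomp, neg_add_cancel, hzero] at h
  rw [← h, show -(y - x) = -y + x by abel]

/-- **The pair integral of the torus Wilson state is even in the separation**: `∫ F(Ũ) F(τ_{−z} Ũ) = ∫ F(Ũ) F(τ_z Ũ)`. [folklore] -/
theorem pair_integral_neg (r : LatticeRep G) (β : ℝ) (L : ℕ) (F : LGConfig 4 G → ℝ) (z : Site 4) :
    ∫ U, F (torusLift (2 * L + 1) U) * F (configShift z (torusLift (2 * L + 1) U))
        ∂(wilsonMeasure r.ρ β : Measure (GaugeConfig 4 (2 * L + 1) G)) =
      ∫ U, F (torusLift (2 * L + 1) U) * F (configShift (-z) (torusLift (2 * L + 1) U))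
        ∂(wilsonMeasure r.ρ β : Measure (GaugeConfig 4 (2 * L + 1) G)) := by
  -- adapted from `CurvatureKernel.torusCov_neg_eq` (module not served at the time of writing)
  have hcomp : ∀ (a b : Site 4) (V : LGConfig 4 G), configShift a (configShift b V) = configShift (a + b) V := by
    intro a b V; funext e; simp only [configShift_apply, sub_sub]
  have hzero : ∀ V : LGConfig 4 G, configShift (0 : Site 4) V = V := by
    intro V; funext e; simp [configShift_apply]
  have h2 := integral_comp_configShift_torusLift (d := 4) (S := 2 * L + 1) r.ρ β
    (fun V => F (configShift (-z) V) * F V) z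
  simp only [hcomp, neg_add_cancel, hzero] at h2
  rw [h2]
  exact integral_congr_ae (Eventually.of_forall fun U => mul_comm _ _)

/-- **The centred two-point weight is the truncated covariance at the separation `z = x₀ − x₁`**, in the letters of
✓`CurvatureKernel.AxisDominationOfForm`: `W(x₀, x₁) = ∫ Q(Ũ) Q(τ_z Ũ) dμ − (∫ Q(Ũ) dμ)(∫ Q(τ_z Ũ) dμ)` (translation invariance of
Wilson's torus measure and evenness of the covariance). [folklore] -/
theorem torusMoment_two_eq_cov (r : LatticeRep G) (β : ℝ) (L : ℕ) (x : Fin 2 → Site 4) :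
    torusMoment r.ρ β L r.curvature.F (wilsonTorusMean r.ρ β L r.curvature.F) x =
      (∫ U, r.curvature.F (torusLift (2 * L + 1) U) * r.curvature.F (configShift (-(x 0 - x 1)) (torusLift (2 * L + 1) U))
          ∂(wilsonMeasure r.ρ β : Measure (GaugeConfig 4 (2 * L + 1) G))) -
        (∫ U, r.curvature.F (torusLift (2 * L + 1) U) ∂(wilsonMeasure r.ρ β : Measure (GaugeConfig 4 (2 * L + 1) G))) *
        (∫ U, r.curvature.F (configShift (-(x 0 - x 1)) (torusLift (2 * L + 1) U))
          ∂(wilsonMeasure r.ρ β : Measure (GaugeConfig 4 (2 * L + 1) G))) := by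
  rw [torusMoment_two]
  unfold torusE dens
  rw [integral_mul_shift_lift r β L r.curvature.F r.curvature.F (x 0) (x 1),
    integral_shift_lift r β L r.curvature.F (x 0), integral_shift_lift r β L r.curvature.F (x 1),
    integral_shift_lift r β L r.curvature.F (x 0 - x 1), show -(x 1 - x 0) = x 0 - x 1 from neg_sub (x 1) (x 0),
    pair_integral_neg r β L r.curvature.F (x 0 - x 1)]

/-- **Axis domination under a two-sided axis window.**  For a separation `z` with time component `z₀ = n ≥ 3` and `B ≥ 0`: if the axis
covariance `lCC(Q^θ, Q, 2⌊n/2⌋)` is non-negative and `Cov(Q_0,Q_z)² ≤ lCC(Q,Q^θ,2⌈n/2⌉)·lCC(Q^θ,Q,2⌊n/2⌋)` (the conclusion of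
✓`CurvatureKernel.AxisDominationOfForm`), and the window bounds `(2⌈n/2⌉)⁸·lCC(Q,Q^θ,2⌈n/2⌉) ≤ B`, `(2⌊n/2⌋)⁸·lCC(Q^θ,Q,2⌊n/2⌋) ≤ B` hold,
then `|Cov(Q_0, Q_z)| ≤ B / (n − 1)⁸` (`2⌈n/2⌉, 2⌊n/2⌋ ≥ n − 1`). [cite: OsterwalderSeiler1978, §2] -/
theorem abs_cov_le_of_axis_window (r : LatticeRep G) (β : ℝ) (L : ℕ) (z : Site 4) (n : ℕ) (hn3 : 3 ≤ n) {B : ℝ} (hB0 : 0 ≤ B)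
    (hpos2 : 0 ≤ latticeConnectedCorr r.ρ β (2 * L + 1) r.curvature.timeReflect.F r.curvature.F (2 * (n / 2)))
    (hsq : ((∫ U, r.curvature.F (torusLift (2 * L + 1) U) * r.curvature.F (configShift (-z) (torusLift (2 * L + 1) U))
          ∂(wilsonMeasure r.ρ β : Measure (GaugeConfig 4 (2 * L + 1) G))) -
        (∫ U, r.curvature.F (torusLift (2 * L + 1) U) ∂(wilsonMeasure r.ρ β : Measure (GaugeConfig 4 (2 * L + 1) G))) *
        (∫ U, r.curvature.F (configShift (-z) (torusLift (2 * L + 1) U))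
          ∂(wilsonMeasure r.ρ β : Measure (GaugeConfig 4 (2 * L + 1) G)))) ^ 2 ≤
      latticeConnectedCorr r.ρ β (2 * L + 1) r.curvature.F r.curvature.timeReflect.F (2 * ((n + 1) / 2)) *
        latticeConnectedCorr r.ρ β (2 * L + 1) r.curvature.timeReflect.F r.curvature.F (2 * (n / 2)))
    (h1 : ((2 * ((n + 1) / 2) : ℕ) : ℝ) ^ 8 *
        latticeConnectedCorr r.ρ β (2 * L + 1) r.curvature.F r.curvature.timeReflect.F (2 * ((n + 1) / 2)) ≤ B)
    (h2 : ((2 * (n / 2) : ℕ) : ℝ) ^ 8 *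
        latticeConnectedCorr r.ρ β (2 * L + 1) r.curvature.timeReflect.F r.curvature.F (2 * (n / 2)) ≤ B) :
    |(∫ U, r.curvature.F (torusLift (2 * L + 1) U) * r.curvature.F (configShift (-z) (torusLift (2 * L + 1) U))
          ∂(wilsonMeasure r.ρ β : Measure (GaugeConfig 4 (2 * L + 1) G))) -
        (∫ U, r.curvature.F (torusLift (2 * L + 1) U) ∂(wilsonMeasure r.ρ β : Measure (GaugeConfig 4 (2 * L + 1) G))) *
        (∫ U, r.curvature.F (configShift (-z) (torusLift (2 * L + 1) U))
          ∂(wilsonMeasure r.ρ β : Measure (GaugeConfig 4 (2 * L + 1) G)))| ≤ B / ((n : ℝ) - 1) ^ 8 := by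
  set A₁ := latticeConnectedCorr r.ρ β (2 * L + 1) r.curvature.F r.curvature.timeReflect.F (2 * ((n + 1) / 2)) with hA₁
  set A₂ := latticeConnectedCorr r.ρ β (2 * L + 1) r.curvature.timeReflect.F r.curvature.F (2 * (n / 2)) with hA₂
  -- the two lattice times are `≥ n − 1 ≥ 2`
  have ht1 : (n : ℝ) - 1 ≤ ((2 * ((n + 1) / 2) : ℕ) : ℝ) := by
    have : n - 1 ≤ 2 * ((n + 1) / 2) := by omega
    have h' : ((n - 1 : ℕ) : ℝ) ≤ ((2 * ((n + 1) / 2) : ℕ) : ℝ) := by exact_mod_cast this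
    rwa [Nat.cast_sub (by omega), Nat.cast_one] at h'
  have ht2 : (n : ℝ) - 1 ≤ ((2 * (n / 2) : ℕ) : ℝ) := by
    have : n - 1 ≤ 2 * (n / 2) := by omega
    have h' : ((n - 1 : ℕ) : ℝ) ≤ ((2 * (n / 2) : ℕ) : ℝ) := by exact_mod_cast this
    rwa [Nat.cast_sub (by omega), Nat.cast_one] at h'
  have hm0 : 0 < (n : ℝ) - 1 := by
    have : (3 : ℝ) ≤ n := by exact_mod_cast hn3
    linarith
  set M : ℝ := ((n : ℝ) - 1) ^ 8 with hM
  have hM0 : 0 < M := by positivity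
  -- `A₁ ≤ B / M`, `A₂ ≤ B / M`
  have hA₁le : A₁ ≤ B / M := by
    have hp : 0 < ((2 * ((n + 1) / 2) : ℕ) : ℝ) ^ 8 := pow_pos (hm0.trans_le ht1) 8
    have h' : A₁ ≤ B / ((2 * ((n + 1) / 2) : ℕ) : ℝ) ^ 8 := by
      rw [le_div_iff₀ hp, mul_comm]; exact h1
    refine h'.trans (div_le_div_of_nonneg_left hB0 hM0 ?_)
    exact pow_le_pow_left₀ hm0.le ht1 8
  have hA₂le : A₂ ≤ B / M := by
    have hp : 0 < ((2 * (n / 2) : ℕ) : ℝ) ^ 8 := pow_pos (hm0.trans_le ht2) 8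
    have h' : A₂ ≤ B / ((2 * (n / 2) : ℕ) : ℝ) ^ 8 := by
      rw [le_div_iff₀ hp, mul_comm]; exact h2
    refine h'.trans (div_le_div_of_nonneg_left hB0 hM0 ?_)
    exact pow_le_pow_left₀ hm0.le ht2 8
  -- `Cov² ≤ A₁ A₂ ≤ (B/M)²`
  have hprod : A₁ * A₂ ≤ (B / M) ^ 2 := by
    rw [sq]
    exact mul_le_mul hA₁le hA₂le hpos2 (div_nonneg hB0 hM0.le)
  exact abs_le_of_sq_le_sq (hsq.trans hprod) (div_nonneg hB0 hM0.le)

end Summit.QuantumFields.YangMills.Theorems.F4SubCurvatureDoorSubCurvatureClauseLatticeToAxisTools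

end
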